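import Literature.AnabelianGeometry.EtaleTheta.KummerTwistInertia
import Literature.IUT.HodgeTheaters.GlobalFrobenioidsCoricRigidityOfDivisors
import HarnessLib

/-!
# [IUTchI] Example 5.1 (v), pp. 127–128, "respectively, ∞κ×-coric": laws (a) and (b′) at the GENUINE Kummer map
# for ANY `π₁^rat`-stable root-closed pseudo-monoid of rational functions — the ∞κ×-pair included (proof-only)

S. Mochizuki, *Inter-universal Teichmüller theory I*, kurims manuscript (May 2020), §5 Example 5.1 (v), p. 127
l. 13 – p. 128 l. 54 ([IUTchI] Ex 5.1 (v) pp.127–128) [claim: Mochizuki2012, status: disputed]: "an ∞κ-coric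
(respectively, ∞κ×-coric) structure on `†ℱ^⊛` … the asserted injectivity … by considering divisors of zeroes and
poles … associated to Kummer classes of rational functions as in [AbsTopIII], Proposition 1.6, (iii) … `†ℱ^⊛`
always admits an ∞κ-coric (respectively, ∞κ×-coric) structure, which is, moreover, unique up to a uniquely
determined isomorphism"; Remark 3.1.7 (ii) p. 68 l. 1–4: "in the case of ∞κ- and ∞κ×-coric rational functions,
the resulting pseudo-monoid is *divisible* and *cyclotomic*" — [IUTchI] §0 p. 33: "`a ∈ M` lies in `ι(P)` if and
only if `aⁿ` lies in `ι(P)`" (root- AND power-closure).  [AbsTopIII] Prop. 1.6 (iii) p. 36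
[MochizukiAbsTopIII2015]; LANA §6.1 pp. 31–32 [LANA2026Report] (the Kummer map).

Sub-DAG `plan/L5/SUBDAG-IUTchI-Ex51.md` rows E51/L25–L27, L29 ("respectively ∞κ×" halves); GAP-LEDGER G-w4d056-2;
node IUTchI:Ex5.1(v); LAYER-5 certificate row 1116 conjunct 2.  PROOF-ONLY: no definition, no instance, no new
`Prop` fact.

**State before this file.**  abc-iut-w4-d056's `GlobalFrobenioidsCoricKummerNaturality` / `…GenuineKummer` /
`…OfInertia` (p431351, p432037, READY) do the ∞κ-pair `N.infκPair` only.  THIS FILE redoes the three steps for an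
ARBITRARY `π₁^rat`-stable subset `M ⊆ K_rat` with `0 ∉ M` (abc-iut-w5-d110's `NFBridgeRecon.coricPairOfSubset M hM`;
`N.infκPair`, `N.infκxPair` are its instances) under the printed hypotheses `1 ∈ M`, `f ∈ M ⇔ fⁿ ∈ M` ("divisible",
Rmk 3.1.7 (ii); THEOREMS at abc-iut-L5-t2's model: `CriticalLocus.isInftyKappaCoricIn_pow_iff`,
`isInftyKappaUnitCoricIn_pow_iff`, `KappaCoricPseudoMonoidsProofs.lean`), and derives the **∞κ×** closers:
* `NFBridgeRecon.subset_exists_zhatTwist_kummerMap_iso` — LAW (a) at the pair `π₁^rat ↷ M` for the genuine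
  `kummerMap` (engine `exists_zhatTwist_kummerMap_of_partialMul`);
* `NFBridgeRecon.kummerMap_mk0_realizes_of_subset`, `kummerMap_mk0_smul_of_subset` — the genuine Kummer map
  REALISES the pseudo-monoid `M` (§0 p. 33) and is `π₁^rat`-equivariant (L2 `CoMorphism.conjColimMulAut`);
* `NFBridgeRecon.kummerMap_hord_of_inertia_of_subset` — LAW (b′) from the inertia data (i)(ii)(iii) at the
  points (engine `apply_eta_eq_eta_of_kummerMap_eq_twist`, [AbsTopIII] Prop. 1.6 (iii));
* **`NFBridgeRecon.existsUniqueCoricStructure_infκxPair_kummerMap`**, **`…_infκxPair_of_inertia`**,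
  **`…_infκxPair_of_inertia_of_fixedRoots`** — "respectively, ∞κ×-coric": `ExistsUniqueCoricStructure π₁^rat
  𝕄^⊛_∞κ×(†𝒟^⊚)` at the GENUINE Kummer map, with NO container / Kummer-realisation / `Ẑ^×`-element / law (a)
  assumed, and (last two) with (b′) replaced by the inertia laws — closer: abc-iut-w4-d056's
  `existsUniqueCoricStructure_infκxPair_of_divisors` (p424116).
No side is taken on [IUTchIII] Cor. 3.12; nothing of the disputed series is asserted; typed ≠ proved.
-/

namespace Literature.IUT.HodgeTheaters

open ProfiniteGrp ProfiniteGrp.ProfiniteCompletion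
open Literature.AnabelianGeometry.EtaleTheta Literature.AnabelianGeometry.EtaleTheta.ZHatLevel

namespace NFBridgeRecon

variable (N : NFBridgeRecon.{0}) (M : Set N.Krat) (hM : ∀ (g : N.piRat) {f : N.Krat}, f ∈ M → g • f ∈ M)

/-! ### A `π₁^rat`-stable pseudo-monoid of nonzero rational functions inside `K_rat^×` -/

section Subset

/-- Elements of a pseudo-monoid `M ⊆ K_rat` with `0 ∉ M` are nonzero. ([IUTchI] Ex 5.1 (v) p.127)
[claim: Mochizuki2012, status: disputed] -/
theorem coe_ne_zero_of_subset (h0 : (0 : N.Krat) ∉ M) (x : (N.coricPairOfSubset M hM).carrier) :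
    (x : N.Krat) ≠ 0 := fun h => h0 (h ▸ x.2)

omit hM in
/-- Root- and power-closure of `M` transferred to `K_rat^×`. ([IUTchI] Rmk 3.1.7 (ii) p.68)
[claim: Mochizuki2012, status: disputed] -/
theorem units_preimage_pow_iff_of_subset (hpow : ∀ (f : N.Krat) (n : ℕ), 0 < n → (f ∈ M ↔ f ^ n ∈ M))
    (a : N.Kratˣ) (n : ℕ) (hn : 0 < n) :
    a ∈ (Units.val ⁻¹' M : Set N.Kratˣ) ↔ a ^ n ∈ (Units.val ⁻¹' M : Set N.Kratˣ) := by
  rw [Set.mem_preimage, Set.mem_preimage, Units.val_pow_eq_pow_val]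
  exact hpow _ n hn

variable [MulDistribMulAction N.piRat N.Kratˣ]

include hM in
/-- `M`, viewed in `K_rat^×`, is `π₁^rat`-stable (any units action compatible with the field action).
([IUTchI] Ex 5.1 (v) p.127) [claim: Mochizuki2012, status: disputed] -/
theorem units_preimage_smul_mem_of_subset
    (hcoe : ∀ (g : N.piRat) (a : N.Kratˣ), ((g • a : N.Kratˣ) : N.Krat) = g • (a : N.Krat))
    (g : N.piRat) (a : N.Kratˣ) (ha : a ∈ (Units.val ⁻¹' M : Set N.Kratˣ)) :
    g • a ∈ (Units.val ⁻¹' M : Set N.Kratˣ) := by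
  rw [Set.mem_preimage, hcoe]
  exact hM g ha

variable (e : CoricPair.Iso (N.coricPairOfSubset M hM) (N.coricPairOfSubset M hM))

omit [MulDistribMulAction N.piRat N.Kratˣ] in
/-- Some map `K_rat^× → K_rat^×` extends the automorphism `e` of the pair `π₁^rat ↷ M`.
([IUTchI] Ex 5.1 (v) p.127) [claim: Mochizuki2012, status: disputed] -/
theorem exists_units_extension_of_subset (h0 : (0 : N.Krat) ∉ M) :
    ∃ eU : N.Kratˣ → N.Kratˣ, ∀ (a : N.Kratˣ) (h : (a : N.Krat) ∈ M),
      (eU a : N.Krat) = ((e.toEquiv ⟨(a : N.Krat), h⟩ : (N.coricPairOfSubset M hM).carrier) : N.Krat) := by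
  classical
  refine ⟨fun a => if h : (a : N.Krat) ∈ M then
      Units.mk0 ((e.toEquiv ⟨(a : N.Krat), h⟩ : (N.coricPairOfSubset M hM).carrier) : N.Krat)
        (N.coe_ne_zero_of_subset M hM h0 _)
    else a, fun a h => ?_⟩
  simp only [dif_pos h, Units.val_mk0]

variable {eU : N.Kratˣ → N.Kratˣ}
  (he : ∀ (a : N.Kratˣ) (h : (a : N.Krat) ∈ M),
    (eU a : N.Krat) = ((e.toEquiv ⟨(a : N.Krat), h⟩ : (N.coricPairOfSubset M hM).carrier) : N.Krat))

include he

omit [MulDistribMulAction N.piRat N.Kratˣ] in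
/-- An extension of `e` maps `M` into `M`. ([IUTchI] Ex 5.1 (v) p.127) [claim: Mochizuki2012, status: disputed] -/
theorem units_extension_mem_of_subset (a : N.Kratˣ) (ha : a ∈ (Units.val ⁻¹' M : Set N.Kratˣ)) :
    eU a ∈ (Units.val ⁻¹' M : Set N.Kratˣ) := by
  rw [Set.mem_preimage, he a ha]
  exact (e.toEquiv ⟨(a : N.Krat), ha⟩).2

omit [MulDistribMulAction N.piRat N.Kratˣ] in
/-- An extension of `e` is multiplicative on products staying in `M` (`CoricPair.Iso.op` for
`coricPairOfSubset`: the partial multiplication is the field multiplication restricted to such pairs).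
([IUTchI] Ex 5.1 (v) p.127) [claim: Mochizuki2012, status: disputed] -/
theorem units_extension_mul_of_subset (a : N.Kratˣ) (ha : a ∈ (Units.val ⁻¹' M : Set N.Kratˣ)) (b : N.Kratˣ)
    (hb : b ∈ (Units.val ⁻¹' M : Set N.Kratˣ)) (hab : a * b ∈ (Units.val ⁻¹' M : Set N.Kratˣ)) :
    eU (a * b) = eU a * eU b := by
  have hab' : ((a : N.Krat) * b) ∈ M := by rwa [Set.mem_preimage, Units.val_mul] at hab
  apply Units.ext
  rw [Units.val_mul, he a ha, he b hb, he (a * b) hab]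
  have hop := e.op ⟨((⟨(a : N.Krat), ha⟩ : (N.coricPairOfSubset M hM).carrier),
    (⟨(b : N.Krat), hb⟩ : (N.coricPairOfSubset M hM).carrier)), hab'⟩
  exact congrArg (fun y : (N.coricPairOfSubset M hM).carrier => (y : N.Krat)) hop

/-- An extension of `e` is `π₁^rat`-equivariant on `M` (`CoricPair.Iso.smul`). ([IUTchI] Ex 5.1 (v) p.127)
[claim: Mochizuki2012, status: disputed] -/
theorem units_extension_smul_of_subset
    (hcoe : ∀ (g : N.piRat) (a : N.Kratˣ), ((g • a : N.Kratˣ) : N.Krat) = g • (a : N.Krat))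
    (g : N.piRat) (a : N.Kratˣ) (ha : a ∈ (Units.val ⁻¹' M : Set N.Kratˣ)) :
    eU (g • a) = g • eU a := by
  have hga : g • a ∈ (Units.val ⁻¹' M : Set N.Kratˣ) := N.units_preimage_smul_mem_of_subset M hM hcoe g a ha
  apply Units.ext
  rw [hcoe, he a ha, he (g • a) hga]
  have hx : (⟨((g • a : N.Kratˣ) : N.Krat), hga⟩ : (N.coricPairOfSubset M hM).carrier) =
      g • (⟨(a : N.Krat), ha⟩ : (N.coricPairOfSubset M hM).carrier) := Subtype.ext (hcoe g a)
  rw [hx, e.smul]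
  rfl

omit [MulDistribMulAction N.piRat N.Kratˣ] in
/-- An extension of `e⁻¹` inverts an extension of `e` on `M`. ([IUTchI] Ex 5.1 (v) p.127)
[claim: Mochizuki2012, status: disputed] -/
theorem units_extension_symm_apply_of_subset {eV : N.Kratˣ → N.Kratˣ}
    (he' : ∀ (a : N.Kratˣ) (h : (a : N.Krat) ∈ M),
      (eV a : N.Krat) = ((e.symm.toEquiv ⟨(a : N.Krat), h⟩ : (N.coricPairOfSubset M hM).carrier) : N.Krat))
    (a : N.Kratˣ) (ha : a ∈ (Units.val ⁻¹' M : Set N.Kratˣ)) : eV (eU a) = a := by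
  have hea : eU a ∈ (Units.val ⁻¹' M : Set N.Kratˣ) := N.units_extension_mem_of_subset M hM e he a ha
  apply Units.ext
  rw [he' (eU a) hea]
  have hx : (⟨((eU a : N.Kratˣ) : N.Krat), hea⟩ : (N.coricPairOfSubset M hM).carrier) =
      e.toEquiv (⟨(a : N.Krat), ha⟩ : (N.coricPairOfSubset M hM).carrier) := Subtype.ext (he a ha)
  rw [hx]
  exact congrArg (fun y : (N.coricPairOfSubset M hM).carrier => (y : N.Krat)) (e.toEquiv.symm_apply_apply _)

end Subset

/-! ### Law (a) at the pair `π₁^rat ↷ M` for the genuine Kummer map -/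

section LawA

variable [MulDistribMulAction N.piRat N.Kratˣ] {ι : Type} [Preorder ι] [DecidableEq ι] [IsDirectedOrder ι]
  (S : ι → Subgroup N.piRat) (hS : ∀ ⦃i j : ι⦄, i ≤ j → S j ≤ S i) [RootableBy N.Kratˣ ℕ]

/-- **LAW (a) at the pair `π₁^rat ↷ M`** for ANY `π₁^rat`-stable `M ⊆ K_rat` with `0 ∉ M`, `1 ∈ M`,
`f ∈ M ⇔ fⁿ ∈ M` (e.g. `𝕄^⊛_∞κ×(†𝒟^⊚)`, "divisible", Rmk 3.1.7 (ii)): every automorphism `e` of the pair acts on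
the genuine Kummer classes `κ(f) = kummerMap f` through some `u ∈ Ẑ^× = Aut(Ẑ)` — `κ(e f) = u · κ(f)` — its
cyclotomic character on `μ_∞ ⊆ M`.  PROVED. ([IUTchI] Ex 5.1 (v) p.127) [claim: Mochizuki2012, status: disputed] -/
theorem subset_exists_zhatTwist_kummerMap_iso (h0 : (0 : N.Krat) ∉ M)
    (hcoe : ∀ (g : N.piRat) (a : N.Kratˣ), ((g • a : N.Kratˣ) : N.Krat) = g • (a : N.Krat))
    (hprim : ∀ n : ℕ, 0 < n → ∃ ζ : N.Krat, IsPrimitiveRoot ζ n) (hc : IsExhausted N.Kratˣ S)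
    (h1 : (1 : N.Krat) ∈ M) (hpow : ∀ (f : N.Krat) (n : ℕ), 0 < n → (f ∈ M ↔ f ^ n ∈ M))
    (e : CoricPair.Iso (N.coricPairOfSubset M hM) (N.coricPairOfSubset M hM)) :
    ∃ u : MulAut (completion (GrpCat.of (Multiplicative ℤ))),
      ∀ x : (N.coricPairOfSubset M hM).carrier,
        kummerMap hS hc (Units.mk0 ((e.toEquiv x : (N.coricPairOfSubset M hM).carrier) : N.Krat)
          (N.coe_ne_zero_of_subset M hM h0 _)) =
          H1ColimTwist S hS u (kummerMap hS hc (Units.mk0 (x : N.Krat) (N.coe_ne_zero_of_subset M hM h0 x))) := by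
  obtain ⟨eU, he⟩ := N.exists_units_extension_of_subset M hM e h0
  obtain ⟨eV, he'⟩ := N.exists_units_extension_of_subset M hM e.symm h0
  have h1' : (1 : N.Kratˣ) ∈ (Units.val ⁻¹' M : Set N.Kratˣ) := by
    rw [Set.mem_preimage, Units.val_one]; exact h1
  obtain ⟨u, -, hκ⟩ := exists_zhatTwist_kummerMap_of_partialMul S hS hprim hc
    (N.units_preimage_smul_mem_of_subset M hM hcoe) h1' (N.units_preimage_pow_iff_of_subset M hpow)
    (N.units_extension_mul_of_subset M hM e he) (N.units_extension_mul_of_subset M hM e.symm he')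
    (N.units_extension_symm_apply_of_subset M hM e he he')
    (fun a ha => N.units_extension_symm_apply_of_subset M hM e.symm he' (eU := eV) (eV := eU)
      (fun b hb => by rw [he b hb]; rfl) a ha)
    (N.units_extension_smul_of_subset M hM e he hcoe)
  refine ⟨u, fun x => ?_⟩
  have hx : Units.mk0 (x : N.Krat) (N.coe_ne_zero_of_subset M hM h0 x) ∈ (Units.val ⁻¹' M : Set N.Kratˣ) := by
    rw [Set.mem_preimage, Units.val_mk0]; exact x.2
  have hex : eU (Units.mk0 (x : N.Krat) (N.coe_ne_zero_of_subset M hM h0 x)) =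
      Units.mk0 ((e.toEquiv x : (N.coricPairOfSubset M hM).carrier) : N.Krat)
        (N.coe_ne_zero_of_subset M hM h0 _) := by
    apply Units.ext
    have hxe : (⟨((Units.mk0 (x : N.Krat) (N.coe_ne_zero_of_subset M hM h0 x) : N.Kratˣ) : N.Krat), hx⟩ :
        (N.coricPairOfSubset M hM).carrier) = x := Subtype.ext (Units.val_mk0 (N.coe_ne_zero_of_subset M hM h0 x))
    rw [he _ hx, hxe, Units.val_mk0]
  rw [← hex]
  exact hκ _ hx

/-! ### The genuine Kummer map realises `M` and is equivariant -/

/-- `Units.mk0` is multiplicative on elements of `M`. ([IUTchI] Ex 5.1 (v) p.127) [claim: Mochizuki2012, status: disputed] -/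
theorem kummerMap_mk0_mul_of_subset (h0 : (0 : N.Krat) ∉ M) (hc : IsExhausted N.Kratˣ S)
    (x y : (N.coricPairOfSubset M hM).carrier) (h : (x : N.Krat) * y ≠ 0) :
    kummerMap hS hc (Units.mk0 ((x : N.Krat) * y) h) =
      kummerMap hS hc (Units.mk0 (x : N.Krat) (N.coe_ne_zero_of_subset M hM h0 x)) +
        kummerMap hS hc (Units.mk0 (y : N.Krat) (N.coe_ne_zero_of_subset M hM h0 y)) := by
  rw [show Units.mk0 ((x : N.Krat) * y) h = Units.mk0 (x : N.Krat) (N.coe_ne_zero_of_subset M hM h0 x) *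
    Units.mk0 (y : N.Krat) (N.coe_ne_zero_of_subset M hM h0 y) from Units.ext rfl, kummerMap_mul]

/-- **The genuine Kummer map REALISES the pseudo-monoid `M`** ([IUTchI] §0 p. 33) in the container
`Multiplicative (lim_{→ i} H¹(S i, Λ K_rat^×))`, given its injectivity on `K_rat^×` (E51/L26).  PROVED.
([IUTchI] Ex 5.1 (v) p.127) [claim: Mochizuki2012, status: disputed] -/
theorem kummerMap_mk0_realizes_of_subset (h0 : (0 : N.Krat) ∉ M) (hc : IsExhausted N.Kratˣ S)
    (hinj : Function.Injective (kummerMap hS hc)) :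
    (N.coricPairOfSubset M hM).pm.IsRealizedBy (Multiplicative (H1Colimit N.Kratˣ S hS))
      (fun x => Multiplicative.ofAdd
        (kummerMap hS hc (Units.mk0 (x : N.Krat) (N.coe_ne_zero_of_subset M hM h0 x)))) := by
  refine ⟨fun x y hxy => ?_, Set.ext fun p => ?_, fun p => ?_⟩
  · have h := hinj (Multiplicative.ofAdd.injective hxy)
    exact Subtype.ext ((Units.val_mk0 (N.coe_ne_zero_of_subset M hM h0 x)).symm.trans
      ((congrArg Units.val h).trans (Units.val_mk0 (N.coe_ne_zero_of_subset M hM h0 y))))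
  · change (p.1 : N.Krat) * p.2 ∈ M ↔ _
    constructor
    · intro hp
      refine ⟨⟨(p.1 : N.Krat) * p.2, hp⟩, ?_⟩
      change Multiplicative.ofAdd (kummerMap hS hc (Units.mk0 ((p.1 : N.Krat) * p.2) _)) = _
      rw [N.kummerMap_mk0_mul_of_subset M hM S hS h0 hc p.1 p.2, ofAdd_add]
    · rintro ⟨c, hcp⟩
      have hmul : (p.1 : N.Krat) * p.2 ≠ 0 :=
        mul_ne_zero (N.coe_ne_zero_of_subset M hM h0 _) (N.coe_ne_zero_of_subset M hM h0 _)
      have h' : kummerMap hS hc (Units.mk0 (c : N.Krat) (N.coe_ne_zero_of_subset M hM h0 c)) =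
          kummerMap hS hc (Units.mk0 ((p.1 : N.Krat) * p.2) hmul) := by
        rw [N.kummerMap_mk0_mul_of_subset M hM S hS h0 hc p.1 p.2 hmul, ← ofAdd_add] at *
        exact Multiplicative.ofAdd.injective hcp
      have hval : (c : N.Krat) = (p.1 : N.Krat) * p.2 :=
        (Units.val_mk0 (N.coe_ne_zero_of_subset M hM h0 c)).symm.trans
          ((congrArg Units.val (hinj h')).trans (Units.val_mk0 hmul))
      rw [← hval]
      exact c.2
  · change Multiplicative.ofAdd (kummerMap hS hc (Units.mk0 ((p.1.1 : N.Krat) * p.1.2) _)) = _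
    rw [N.kummerMap_mk0_mul_of_subset M hM S hS h0 hc p.1.1 p.1.2, ofAdd_add]

variable [Nonempty ι] [hN : ∀ i, (S i).Normal]

/-- **`π₁^rat`-equivariance of the genuine Kummer map on `M`** for the natural conjugation action on the
container (`CoMorphism.conjColimMulAut`).  PROVED. ([IUTchI] Ex 5.1 (v) p.127) [claim: Mochizuki2012, status: disputed] -/
theorem kummerMap_mk0_smul_of_subset (h0 : (0 : N.Krat) ∉ M)
    (hcoe : ∀ (g : N.piRat) (a : N.Kratˣ), ((g • a : N.Kratˣ) : N.Krat) = g • (a : N.Krat))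
    (hc : IsExhausted N.Kratˣ S) (g : N.piRat) (x : (N.coricPairOfSubset M hM).carrier) :
    Multiplicative.ofAdd (kummerMap hS hc
        (Units.mk0 ((g • x : (N.coricPairOfSubset M hM).carrier) : N.Krat) (N.coe_ne_zero_of_subset M hM h0 _))) =
      CoMorphism.conjColimMulAut S hS g
        (Multiplicative.ofAdd (kummerMap hS hc (Units.mk0 (x : N.Krat) (N.coe_ne_zero_of_subset M hM h0 x)))) := by
  rw [CoMorphism.conjColimMulAut_ofAdd_kummerMap]
  congr 2
  apply Units.ext
  rw [Units.val_mk0, hcoe, Units.val_mk0]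
  rfl

/-! ### Law (b′) at the pair `π₁^rat ↷ M` from the inertia data -/

omit hN in
/-- **LAW (b′) at the pair `π₁^rat ↷ M` from the INERTIA LAW** ([AbsTopIII] Prop. 1.6 (iii)): per point `x` an
element `τ_x ∈ π₁^rat` with (i) `τ_x` fixes the roots of unity, (ii) a positive power of `τ_x` in every level,
(iii) `τ_x(yₙ)/yₙ = ξ_{x,n}^{ord_x f}` on the compatible roots `y` of every `π₁^rat`-fixed `f ∈ M`; then
`κ(f′) = u · κ(f)` forces `u(η(ord_x f)) = η(ord_x f′)`.  PROVED (engine `apply_eta_eq_eta_of_kummerMap_eq_twist`).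
([IUTchI] Ex 5.1 (v) p.127) [claim: Mochizuki2012, status: disputed] -/
theorem kummerMap_hord_of_inertia_of_subset (h0 : (0 : N.Krat) ∉ M)
    (hcoe : ∀ (g : N.piRat) (a : N.Kratˣ), ((g • a : N.Kratˣ) : N.Krat) = g • (a : N.Krat))
    (hc : IsExhausted N.Kratˣ S) {X : Type*} (ord : X → N.Krat → ℤ) (τ : X → N.piRat)
    (hτμ : ∀ (x : X) (ζ : N.Kratˣ) (n : ℕ+), ζ ^ (n : ℕ) = 1 → τ x • ζ = ζ)
    (hτS : ∀ (x : X) (j : ι), ∃ k : ℕ, 0 < k ∧ τ x ^ k ∈ S j)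
    (ξ : X → ℕ+ → N.Kratˣ) (hξ : ∀ (x : X) (n : ℕ+), IsPrimitiveRoot (ξ x n) n)
    (hval : ∀ (x : X) (f : N.Krat) (hf0 : f ≠ 0), f ∈ M → (∀ g : N.piRat, g • f = f) →
      ∀ (y : RootSystem (Units.mk0 f hf0)) (n : ℕ+), τ x • y.root n / y.root n = (ξ x n) ^ (ord x f))
    (u : MulAut (completion (GrpCat.of (Multiplicative ℤ)))) (f f' : (N.coricPairOfSubset M hM).carrier)
    (hf : ∀ g : N.piRat, g • (f : N.Krat) = f) (hf' : ∀ g : N.piRat, g • (f' : N.Krat) = f')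
    (h : kummerMap hS hc (Units.mk0 (f' : N.Krat) (N.coe_ne_zero_of_subset M hM h0 f')) =
      H1ColimTwist S hS u (kummerMap hS hc (Units.mk0 (f : N.Krat) (N.coe_ne_zero_of_subset M hM h0 f))))
    (x : X) : u (eta (ord x f)) = eta (ord x f') := by
  obtain ⟨i⟩ := ‹Nonempty ι›
  have hinv : ∀ {φ : N.Krat} (hφ0 : φ ≠ 0), (∀ g : N.piRat, g • φ = φ) →
      Units.mk0 φ hφ0 ∈ invariants (A := N.Kratˣ) (S i) := fun hφ0 hfix γ =>
    Units.ext (by rw [show ((γ • Units.mk0 _ hφ0 : N.Kratˣ) : N.Krat) = ((γ : N.piRat) • Units.mk0 _ hφ0 : N.Kratˣ)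
      from rfl, hcoe, Units.val_mk0, hfix])
  exact apply_eta_eq_eta_of_kummerMap_eq_twist S hS hc (hinv (N.coe_ne_zero_of_subset M hM h0 f) hf)
    (hinv (N.coe_ne_zero_of_subset M hM h0 f') hf') u h (τ x) (hτμ x) (hτS x) (ξ x) (hξ x)
    (RootSystem.ofRootableBy _) (hval x f _ f.2 hf _) (RootSystem.ofRootableBy _) (hval x f' _ f'.2 hf' _)

end LawA

/-! ### "Respectively, ∞κ×-coric": the ∞κ×-pair at the genuine Kummer map -/

section InfKappaX

variable [MulDistribMulAction N.piRat N.Kratˣ] {ι : Type} [Preorder ι] [DecidableEq ι] [IsDirectedOrder ι]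
  [Nonempty ι] (S : ι → Subgroup N.piRat) (hS : ∀ ⦃i j : ι⦄, i ≤ j → S j ≤ S i) [hN : ∀ i, (S i).Normal]
  [RootableBy N.Kratˣ ℕ]

/-- **[IUTchI] Ex. 5.1 (v), "respectively, ∞κ×-coric": `ExistsUniqueCoricStructure π₁^rat 𝕄^⊛_∞κ×(†𝒟^⊚)` AT
THE GENUINE KUMMER MAP** — Kummer realisation, container, both actions and law (a) INTERNAL; hypotheses:
structural (`hcoe`; `S` directed exhaustive system of normal subgroups; `K_rat^×` rootable with all roots of
unity; `1 ∈ 𝕄^⊛_∞κ×`, `f ∈ 𝕄^⊛_∞κ× ⇔ fⁿ ∈ 𝕄^⊛_∞κ×` — Rmk 3.1.7 (ii) "divisible"), injectivity of the Kummer map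
(E51/L26), (b′) `hord` on the `π₁^rat`-fixed elements of `𝕄^⊛_∞κ×` at the genuine Kummer map, Rmk 3.1.7 (i)/(ii)
`hpole`/`hex`.  PROVED (closer: `existsUniqueCoricStructure_infκxPair_of_divisors`). ([IUTchI] Ex 5.1 (v) p.128)
[claim: Mochizuki2012, status: disputed] -/
theorem existsUniqueCoricStructure_infκxPair_kummerMap
    (hcoe : ∀ (g : N.piRat) (a : N.Kratˣ), ((g • a : N.Kratˣ) : N.Krat) = g • (a : N.Krat))
    (hprim : ∀ n : ℕ, 0 < n → ∃ ζ : N.Krat, IsPrimitiveRoot ζ n) (hc : IsExhausted N.Kratˣ S)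
    (h1 : (1 : N.Krat) ∈ N.Minfκx) (hpow : ∀ (f : N.Krat) (n : ℕ), 0 < n → (f ∈ N.Minfκx ↔ f ^ n ∈ N.Minfκx))
    (hinj : Function.Injective (kummerMap hS hc))
    {X : Type*} (ord : X → N.Krat → ℤ)
    (hord : ∀ (u : MulAut (completion (GrpCat.of (Multiplicative ℤ)))) (f f' : N.infκxPair.carrier),
      (∀ g : N.piRat, g • (f : N.Krat) = f) → (∀ g : N.piRat, g • (f' : N.Krat) = f') →
      kummerMap hS hc (Units.mk0 (f' : N.Krat) (N.coe_ne_zero_of_subset N.Minfκx _ N.zero_notMem f')) =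
        H1ColimTwist S hS u (kummerMap hS hc
          (Units.mk0 (f : N.Krat) (N.coe_ne_zero_of_subset N.Minfκx _ N.zero_notMem f))) →
      ∀ x : X, u (eta (ord x f)) = eta (ord x f'))
    (hpole : ∀ f' ∈ N.Minfκx, (∀ g : N.piRat, g • f' = f') →
      ∀ x₁ x₂ : X, x₁ ≠ x₂ → ¬ (ord x₁ f' < 0 ∧ ord x₂ f' < 0))
    (hex : ∃ f ∈ N.Minfκx, (∀ g : N.piRat, g • f = f) ∧
      ∃ x₁ x₂ : X, x₁ ≠ x₂ ∧ 0 < ord x₁ f ∧ 0 < ord x₂ f) :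
    ExistsUniqueCoricStructure N.piRat N.infκxPair := by
  letI actZ : MulAction (MulAut (completion (GrpCat.of (Multiplicative ℤ))))
      (Multiplicative (H1Colimit N.Kratˣ S hS)) := MulAction.compHom _ (H1ColimTwistMulAut (A := N.Kratˣ) S hS)
  letI actG : MulAction N.piRat (Multiplicative (H1Colimit N.Kratˣ S hS)) :=
    MulAction.compHom _ (CoMorphism.conjColimMulAut (A := N.Kratˣ) S hS)
  -- the GENUINE Kummer realisation of the model ∞κ×-pair
  let κ₀ : N.infκxPair.KummerRealization (Multiplicative (H1Colimit N.Kratˣ S hS)) :=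
    { toFun := fun x => Multiplicative.ofAdd
        (kummerMap hS hc (Units.mk0 (x : N.Krat) (N.coe_ne_zero_of_subset N.Minfκx _ N.zero_notMem x)))
      realizes := N.kummerMap_mk0_realizes_of_subset N.Minfκx _ S hS N.zero_notMem hc hinj
      smul := fun g x => N.kummerMap_mk0_smul_of_subset N.Minfκx _ S hS N.zero_notMem hcoe hc g x }
  refine N.existsUniqueCoricStructure_infκxPair_of_divisors κ₀ ?_ ord ?_ hpole hex
  · intro e
    obtain ⟨u, hu⟩ := N.subset_exists_zhatTwist_kummerMap_iso N.Minfκx _ S hS N.zero_notMem hcoe hprim hc h1 hpow e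
    exact ⟨u, fun x => congrArg Multiplicative.ofAdd (hu x)⟩
  · intro u f f' hf hf' h x
    exact hord u f f' hf hf' (Multiplicative.ofAdd.injective h) x

/-- **"Respectively, ∞κ×-coric" with (b′) from the INERTIA DATA**: `ExistsUniqueCoricStructure π₁^rat 𝕄^⊛_∞κ×`
at the genuine Kummer map; hypotheses: structural, injectivity of the Kummer map, the inertia laws (i) `hτμ`,
(ii) `hτS`, (iii) `hval` ([AbsTopIII] Prop. 1.6 (iii)) on the `π₁^rat`-fixed elements of `𝕄^⊛_∞κ×`, and Rmk 3.1.7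
(i)/(ii) `hpole`/`hex`.  PROVED. ([IUTchI] Ex 5.1 (v) p.128) [claim: Mochizuki2012, status: disputed] -/
theorem existsUniqueCoricStructure_infκxPair_of_inertia
    (hcoe : ∀ (g : N.piRat) (a : N.Kratˣ), ((g • a : N.Kratˣ) : N.Krat) = g • (a : N.Krat))
    (hprim : ∀ n : ℕ, 0 < n → ∃ ζ : N.Krat, IsPrimitiveRoot ζ n) (hc : IsExhausted N.Kratˣ S)
    (h1 : (1 : N.Krat) ∈ N.Minfκx) (hpow : ∀ (f : N.Krat) (n : ℕ), 0 < n → (f ∈ N.Minfκx ↔ f ^ n ∈ N.Minfκx))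
    (hinj : Function.Injective (kummerMap hS hc))
    {X : Type*} (ord : X → N.Krat → ℤ) (τ : X → N.piRat)
    (hτμ : ∀ (x : X) (ζ : N.Kratˣ) (n : ℕ+), ζ ^ (n : ℕ) = 1 → τ x • ζ = ζ)
    (hτS : ∀ (x : X) (j : ι), ∃ k : ℕ, 0 < k ∧ τ x ^ k ∈ S j)
    (ξ : X → ℕ+ → N.Kratˣ) (hξ : ∀ (x : X) (n : ℕ+), IsPrimitiveRoot (ξ x n) n)
    (hval : ∀ (x : X) (f : N.Krat) (hf0 : f ≠ 0), f ∈ N.Minfκx → (∀ g : N.piRat, g • f = f) →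
      ∀ (y : RootSystem (Units.mk0 f hf0)) (n : ℕ+), τ x • y.root n / y.root n = (ξ x n) ^ (ord x f))
    (hpole : ∀ f' ∈ N.Minfκx, (∀ g : N.piRat, g • f' = f') →
      ∀ x₁ x₂ : X, x₁ ≠ x₂ → ¬ (ord x₁ f' < 0 ∧ ord x₂ f' < 0))
    (hex : ∃ f ∈ N.Minfκx, (∀ g : N.piRat, g • f = f) ∧
      ∃ x₁ x₂ : X, x₁ ≠ x₂ ∧ 0 < ord x₁ f ∧ 0 < ord x₂ f) :
    ExistsUniqueCoricStructure N.piRat N.infκxPair :=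
  N.existsUniqueCoricStructure_infκxPair_kummerMap S hS hcoe hprim hc h1 hpow hinj ord
    (fun u f f' hf hf' h x => N.kummerMap_hord_of_inertia_of_subset N.Minfκx _ S hS N.zero_notMem hcoe hc ord
      τ hτμ hτS ξ hξ hval u f f' hf hf' h x) hpole hex

include hS in
/-- **"Respectively, ∞κ×-coric", modulo laws of the genuine Galois action `π₁^rat ↷ K_rat` ONLY**: as
`existsUniqueCoricStructure_infκxPair_of_inertia`, with the injectivity of the Kummer map replaced by (iv)
`hdiv` — no `S i`-invariant unit other than `1` has `S i`-invariant roots of all orders (Kummer theory of the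
fixed fields; L2 `kummerMapHom_injective_of`).  PROVED. ([IUTchI] Ex 5.1 (v) p.128)
[claim: Mochizuki2012, status: disputed] -/
theorem existsUniqueCoricStructure_infκxPair_of_inertia_of_fixedRoots
    (hcoe : ∀ (g : N.piRat) (a : N.Kratˣ), ((g • a : N.Kratˣ) : N.Krat) = g • (a : N.Krat))
    (hprim : ∀ n : ℕ, 0 < n → ∃ ζ : N.Krat, IsPrimitiveRoot ζ n) (hc : IsExhausted N.Kratˣ S)
    (h1 : (1 : N.Krat) ∈ N.Minfκx) (hpow : ∀ (f : N.Krat) (n : ℕ), 0 < n → (f ∈ N.Minfκx ↔ f ^ n ∈ N.Minfκx))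
    (hdiv : ∀ (i : ι) (a : N.Kratˣ), a ∈ invariants (A := N.Kratˣ) (S i) →
      (∀ n : ℕ+, ∃ b ∈ invariants (A := N.Kratˣ) (S i), b ^ (n : ℕ) = a) → a = 1)
    {X : Type*} (ord : X → N.Krat → ℤ) (τ : X → N.piRat)
    (hτμ : ∀ (x : X) (ζ : N.Kratˣ) (n : ℕ+), ζ ^ (n : ℕ) = 1 → τ x • ζ = ζ)
    (hτS : ∀ (x : X) (j : ι), ∃ k : ℕ, 0 < k ∧ τ x ^ k ∈ S j)
    (ξ : X → ℕ+ → N.Kratˣ) (hξ : ∀ (x : X) (n : ℕ+), IsPrimitiveRoot (ξ x n) n)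
    (hval : ∀ (x : X) (f : N.Krat) (hf0 : f ≠ 0), f ∈ N.Minfκx → (∀ g : N.piRat, g • f = f) →
      ∀ (y : RootSystem (Units.mk0 f hf0)) (n : ℕ+), τ x • y.root n / y.root n = (ξ x n) ^ (ord x f))
    (hpole : ∀ f' ∈ N.Minfκx, (∀ g : N.piRat, g • f' = f') →
      ∀ x₁ x₂ : X, x₁ ≠ x₂ → ¬ (ord x₁ f' < 0 ∧ ord x₂ f' < 0))
    (hex : ∃ f ∈ N.Minfκx, (∀ g : N.piRat, g • f = f) ∧
      ∃ x₁ x₂ : X, x₁ ≠ x₂ ∧ 0 < ord x₁ f ∧ 0 < ord x₂ f) :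
    ExistsUniqueCoricStructure N.piRat N.infκxPair :=
  N.existsUniqueCoricStructure_infκxPair_of_inertia S hS hcoe hprim hc h1 hpow
    (fun a b hab => Additive.ofMul.injective (kummerMapHom_injective_of S hS hc hdiv (a₁ := Additive.ofMul a)
      (a₂ := Additive.ofMul b) hab)) ord τ hτμ hτS ξ hξ hval hpole hex

end InfKappaX

end NFBridgeRecon

end Literature.IUT.HodgeTheaters
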